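import Summits.Ventures.GridStability.Models.WSCC9SplitLurieLines
import Summits.Ventures.GridStability.Lyapunov.WSCC9LossySplitLinesData
import Summits.Ventures.GridStability.Lyapunov.WSCC9LossySplitSlabCast
import Literature.MathematicalPhysics.PowerSystems.LuriePostnikovSlabCertificate
import HarnessLib

/-!
# GridStability/Lyapunov/WSCC9LossySplitLinesCast — the UNORDERED-LINES split object `WSCC9.splitLurieLinesSystem`
# as casts of rational matrices, the KERNEL IDENTITY `−𝓛 = M2q`, and sos-2's 8.008° slab certificate as lit-6's
# `SlabCertificate` («SPLITU-8°», file 2 of 3)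

Cell `gridfusion` (LADDER-GRIDFUSION G2.c lossy tier); seat gridfusion-lit-6 (g9).  Inputs:
`Lyapunov/WSCC9LossySplitLinesData.lean` (sos-2 object `6ece98adcda3423c` padded to 18 channels, kernel-decided
`LDLᵀ` facts), `Models/WSCC9SplitLurieLines.lean` (`WSCC9.splitLurieLinesSystem = postB_SPdamp.toModel.toLitNode.
toSplitLurieLines angleOf`, lit-6 `LossyMultimachineLurieSplitLines`), lit-6's receptacle
`LuriePostnikovSlabCertificate.lean` (`slabMatrix`, `SlabCertificate`), and lyap-2's Cast file of the ORDERED split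
(`WSCC9LossySplitSlabCast`: the index flattenings `e1 / eκ / e2` and the rational `AQ`, `CQ`, `MinvQ` are REUSED by
name — `A`, `C`, `δ*` of the two split presentations coincide by `rfl`; only `B` is new here).

WHAT IS PROVED. (1) STRUCTURE: `S.A`, `S.B`, `S.C` of `S = WSCC9.splitLurieLinesSystem` are the casts of `AQ`,
`BLQ = [lineInputQ; 0]` (sine line `(p,q)`, `p < q`: `+C_pq/M_p` in row `p`, `−C_qp/M_q` in row `q`; cosine line:
`+D_pq/M_p`, `+D_qp/M_q`; columns `p ≥ q` zero — RATIONAL) and `CQ` (`A_eq`, `B_eq`, `C_eq`).  (2) THE KERNEL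
IDENTITY: lit-6's blocks computed over `ℚ` from `AQ, BLQ, CQ` and the certificate data EQUAL the decided literal:
`−[[L₁₁, L₁₂], [L₁₂ᵀ, L₂₂]] = M2q` reindexed (`slabQ_eq`, one `decide +kernel`), hence `−slabMatrix S P η λ τ a b =
(M2q ↦ ℝ)` reindexed (`neg_slabMatrix_eq`) and `P − ε·1 = (Pq − epsQ·1 ↦ ℝ)` reindexed (`P_sub_eq`).  (3) THE
CERTIFICATE `cert : SlabCertificate WSCC9.splitLurieLinesSystem` with the exact data (`P`, `ε = 11501/2²⁴`,
`η = 10⁻⁶`, `τ`, `λ`, `a`, `b`), both matrix facts from the kernel `LDLᵀ` decisions through the identities.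
(4) RANK-ONE facts in `S`-typed form: `rankOne : ∀ k, (s_k • cert.P − C_kC_kᵀ) ⪰ 0` (four class decisions via
the decided reindexing `rankOneQ_eq`).  The sector hypothesis, the level and the sentence are
`Bench/WSCC9LossySplitLinesRoa.lean`.

THREE COLUMNS. CERTIFIED (kernel): the identities and the certificate's defining facts for the MODEL
`WSCC9.splitLurieLinesSystem` = Pai's split Lur'e form (3.43)–(3.45) over UNORDERED lines of M′ =
«WSCC9-postB-SPdamp-h12» (post-fault-B reduction WITH transfer conductances, printed damping `D/M = 1/10, 1/5,
3/10`). VALIDATED: sos-2's solver lineage (CVXOPT), irrelevant to soundness. MODELLED: as `Models/WSCC9.lean` /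
`ClassicalSwingLurie.lean` / `WSCC9SplitLurieLines.lean` (MV-2 + MV-P + MV-SPD + MV-ω + MV-h12). No sentence of
this file says a grid is stable.
-/

noncomputable section

open Matrix
open Literature.MathematicalPhysics.PowerSystems
open Literature.MathematicalPhysics.PowerSystems.LyapunovFunctionFamily
open Literature.Computation.Certificates
open Summit.Ventures.GridStability.Models
open Summit.Ventures.GridStability.Lyapunov.LurieObstruction (tE tM tD)
open Summit.Ventures.GridStability.Lyapunov.WSCC9LossySplitSlab (e1 eκ e2 AQ CQ MinvQ A_eq C_eq)

namespace Summit.Ventures.GridStability.Lyapunov.WSCC9LossySplitLines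

/-! ### The new input matrix over `ℚ` (lit-6's `lineInput`, rational) -/

/-- `lineInput` over `ℚ`: sine line `(p,q)`, `p < q`: `+C_pq/M_p` in row `p`, `−C_qp/M_q` in row `q`; cosine
line: `+D_pq/M_p` and `+D_qp/M_q`; columns with `p ≥ q` zero (the shape of lit-6's definition verbatim). -/
def lineInputQ : Matrix (Fin 3) ((Fin 3 × Fin 3) ⊕ (Fin 3 × Fin 3)) ℚ :=
  Matrix.of fun i k =>
    Sum.elim
      (fun k : Fin 3 × Fin 3 =>
        (if k.1 = i then (if k.1 < k.2 then WSCC9.postB_SPdamp.Cc k.1 k.2 * MinvQ i else 0) else 0)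
          - (if k.2 = i then (if k.1 < k.2 then WSCC9.postB_SPdamp.Cc k.2 k.1 * MinvQ i else 0) else 0))
      (fun k : Fin 3 × Fin 3 =>
        (if k.1 = i then (if k.1 < k.2 then WSCC9.postB_SPdamp.Dc k.1 k.2 * MinvQ i else 0) else 0)
          + (if k.2 = i then (if k.1 < k.2 then WSCC9.postB_SPdamp.Dc k.2 k.1 * MinvQ i else 0) else 0))
      k

/-- `B = [lineInput; 0]` over `ℚ`. -/
def BLQ : Matrix (Fin 3 ⊕ Fin 2) ((Fin 3 × Fin 3) ⊕ (Fin 3 × Fin 3)) ℚ :=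
  Matrix.fromRows lineInputQ 0

/-- `P` on the typed state index. -/
def PQ : Matrix (Fin 3 ⊕ Fin 2) (Fin 3 ⊕ Fin 2) ℚ := Pq.submatrix e1 e1

/-- `τ` on the typed channel index. -/
def tauK (k : (Fin 3 × Fin 3) ⊕ (Fin 3 × Fin 3)) : ℚ := tauQ (eκ k)
/-- `λ` on the typed channel index. -/
def lamK (k : (Fin 3 × Fin 3) ⊕ (Fin 3 × Fin 3)) : ℚ := lamQ (eκ k)
/-- `a` on the typed channel index. -/
def aK (k : (Fin 3 × Fin 3) ⊕ (Fin 3 × Fin 3)) : ℚ := aQ (eκ k)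
/-- `b` on the typed channel index. -/
def bK (k : (Fin 3 × Fin 3) ⊕ (Fin 3 × Fin 3)) : ℚ := bQ (eκ k)
/-- rank-one constant `s` on the typed channel index. -/
def sK (k : (Fin 3 × Fin 3) ⊕ (Fin 3 × Fin 3)) : ℚ := sQ (eκ k)

/-! ### The blocks of `𝓛` over `ℚ` (lit-6's formulas) and the decided identity with `M2q` -/

/-- State block over `ℚ`: `AᵀP + PA + η·1 − Cᵀ·diag(τab)·C`. -/
def L11Q : Matrix (Fin 3 ⊕ Fin 2) (Fin 3 ⊕ Fin 2) ℚ :=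
  AQᵀ * PQ + PQ * AQ + etaQ • (1 : Matrix (Fin 3 ⊕ Fin 2) (Fin 3 ⊕ Fin 2) ℚ)
    - CQᵀ * Matrix.diagonal (fun k => tauK k * (aK k * bK k)) * CQ

/-- Cross block over `ℚ`: `−PB + (CA)ᵀ·diag(λ) + Cᵀ·diag(τ(a+b)/2)`. -/
def L12Q : Matrix (Fin 3 ⊕ Fin 2) ((Fin 3 × Fin 3) ⊕ (Fin 3 × Fin 3)) ℚ :=
  -(PQ * BLQ) + (CQ * AQ)ᵀ * Matrix.diagonal lamK + CQᵀ * Matrix.diagonal (fun k => tauK k * (aK k + bK k) / 2)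

/-- Channel block over `ℚ`: `−diag(λ)·CB − (diag(λ)·CB)ᵀ − diag τ`. -/
def L22Q : Matrix ((Fin 3 × Fin 3) ⊕ (Fin 3 × Fin 3)) ((Fin 3 × Fin 3) ⊕ (Fin 3 × Fin 3)) ℚ :=
  -(Matrix.diagonal lamK * (CQ * BLQ)) - (Matrix.diagonal lamK * (CQ * BLQ))ᵀ - Matrix.diagonal tauK

set_option maxHeartbeats 4000000 in
/-- **The exact certificate matrix**: `−𝓛 = M2q` (reindexed), decided in the kernel over `ℚ`. -/
theorem slabQ_eq : -(Matrix.fromBlocks L11Q L12Q L12Qᵀ L22Q) = M2q.submatrix e2 e2 := by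
  decide +kernel

/-- `PQ` is symmetric (kernel). -/
theorem PQ_transpose : PQᵀ = PQ := by
  decide +kernel

set_option maxHeartbeats 4000000 in
/-- **The rank-one matrices, reindexed**: `s_k·P − C_kᵀC_k` on the typed indices IS the class matrix of the Data
file (kernel, all 18 channels). -/
theorem rankOneQ_eq : ∀ k, sK k • PQ - Matrix.vecMulVec (CQ k) (CQ k)
    = (sClsQ (cls (eκ k)) • Pq - Matrix.vecMulVec (vQ (cls (eκ k))) (vQ (cls (eκ k)))).submatrix e1 e1 := by
  decide +kernel

/-! ### The certificate data over `ℝ` -/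

/-- `P` (real). -/
def P : Matrix (Fin 3 ⊕ Fin 2) (Fin 3 ⊕ Fin 2) ℝ := PQ.map (Rat.cast : ℚ → ℝ)
/-- `τ` (real). -/
def τ : (Fin 3 × Fin 3) ⊕ (Fin 3 × Fin 3) → ℝ := fun k => (tauK k : ℝ)
/-- `λ` (real, Popov coefficients). -/
def lam : (Fin 3 × Fin 3) ⊕ (Fin 3 × Fin 3) → ℝ := fun k => (lamK k : ℝ)
/-- lower slopes (real). -/
def a : (Fin 3 × Fin 3) ⊕ (Fin 3 × Fin 3) → ℝ := fun k => (aK k : ℝ)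
/-- upper slopes (real). -/
def b : (Fin 3 × Fin 3) ⊕ (Fin 3 × Fin 3) → ℝ := fun k => (bK k : ℝ)

/-! ### Cast plumbing -/

/-- `(M·N) ↦ ℝ` = product of the casts (plumbing). -/
private theorem map_mul' {m n o : Type*} [Fintype n] (M : Matrix m n ℚ) (N : Matrix n o ℚ) :
    (M * N).map (Rat.cast : ℚ → ℝ) = M.map (Rat.cast : ℚ → ℝ) * N.map (Rat.cast : ℚ → ℝ) :=
  Matrix.map_mul (f := Rat.castHom ℝ)

/-- `(M+N) ↦ ℝ` = sum of the casts (plumbing). -/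
private theorem map_add' {m n : Type*} (M N : Matrix m n ℚ) :
    (M + N).map (Rat.cast : ℚ → ℝ) = M.map (Rat.cast : ℚ → ℝ) + N.map (Rat.cast : ℚ → ℝ) := by
  ext i j; simp

/-- `(M−N) ↦ ℝ` = difference of the casts (plumbing). -/
private theorem map_sub' {m n : Type*} (M N : Matrix m n ℚ) :
    (M - N).map (Rat.cast : ℚ → ℝ) = M.map (Rat.cast : ℚ → ℝ) - N.map (Rat.cast : ℚ → ℝ) := by
  ext i j; simp

/-- `(−M) ↦ ℝ` = minus the cast (plumbing). -/
private theorem map_neg' {m n : Type*} (M : Matrix m n ℚ) :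
    (-M).map (Rat.cast : ℚ → ℝ) = -M.map (Rat.cast : ℚ → ℝ) := by
  ext i j; simp

/-- transpose commutes with the cast (plumbing, `rfl`). -/
private theorem map_transpose' {m n : Type*} (M : Matrix m n ℚ) :
    Mᵀ.map (Rat.cast : ℚ → ℝ) = (M.map (Rat.cast : ℚ → ℝ))ᵀ := rfl

/-- `diag(d) ↦ ℝ = diag(d ↦ ℝ)` (plumbing). -/
private theorem map_diagonal' {n : Type*} [DecidableEq n] (d : n → ℚ) :
    (Matrix.diagonal d).map (Rat.cast : ℚ → ℝ) = Matrix.diagonal (fun i => (d i : ℝ)) :=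
  Matrix.diagonal_map Rat.cast_zero

/-- `(q·1) ↦ ℝ = (q ↦ ℝ)·1` (plumbing). -/
private theorem map_smul_one' {n : Type*} [DecidableEq n] (q : ℚ) :
    (q • (1 : Matrix n n ℚ)).map (Rat.cast : ℚ → ℝ) = (q : ℝ) • (1 : Matrix n n ℝ) := by
  ext i j
  by_cases h : i = j
  · subst h; simp
  · simp [h]

/-- `(q·M) ↦ ℝ = (q ↦ ℝ)·(M ↦ ℝ)` (plumbing). -/
private theorem map_smul' {m n : Type*} (q : ℚ) (M : Matrix m n ℚ) :
    (q • M).map (Rat.cast : ℚ → ℝ) = (q : ℝ) • M.map (Rat.cast : ℚ → ℝ) := by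
  ext i j; simp

/-- `(v vᵀ) ↦ ℝ = (v ↦ ℝ)(v ↦ ℝ)ᵀ` (plumbing). -/
private theorem map_vecMulVec' {m n : Type*} (v : m → ℚ) (w : n → ℚ) :
    (Matrix.vecMulVec v w).map (Rat.cast : ℚ → ℝ)
      = Matrix.vecMulVec (fun i => (v i : ℝ)) (fun j => (w j : ℝ)) := by
  ext i j; simp [Matrix.vecMulVec_apply]

/-! ### The object `WSCC9.splitLurieLinesSystem`: its matrices are the casts -/

/-- `toLitNode.M = M` (typed rationals). -/
private theorem tM' (i : Fin 3) : WSCC9.postB_SPdamp.toModel.toLitNode.M i = ((WSCC9.M i : ℚ) : ℝ) := by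
  rw [ClassicalSwing.toLitNode_M]; rfl

/-- `toLitNode.C p q = (Cc p q : ℝ)` — the sine weights are the typed rationals `E_pE_qB_pq`. -/
private theorem tC' (p q : Fin 3) :
    WSCC9.postB_SPdamp.toModel.toLitNode.C p q = ((WSCC9.postB_SPdamp.Cc p q : ℚ) : ℝ) := by
  simp only [InternalNode.C, RecastData.Cc, Rat.cast_mul]; rfl

/-- `toLitNode.Dtr p q = (Dc p q : ℝ)` — the cosine weights are the typed rationals `E_pE_qG_pq`. -/
private theorem tDtr' (p q : Fin 3) :
    WSCC9.postB_SPdamp.toModel.toLitNode.Dtr p q = ((WSCC9.postB_SPdamp.Dc p q : ℚ) : ℝ) := by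
  simp only [InternalNode.Dtr, RecastData.Dc, Rat.cast_mul]; rfl

/-- `S.A = AQ ↦ ℝ` (same `A` as the ordered split). -/
theorem A_eq : WSCC9.splitLurieLinesSystem.A = AQ.map (Rat.cast : ℚ → ℝ) := by
  rw [WSCC9.splitLurieLinesSystem_A]; exact WSCC9LossySplitSlab.A_eq

/-- `S.C = CQ ↦ ℝ` (same `C` as the ordered split). -/
theorem C_eq : WSCC9.splitLurieLinesSystem.C = CQ.map (Rat.cast : ℚ → ℝ) := by
  rw [WSCC9.splitLurieLinesSystem_C]; exact WSCC9LossySplitSlab.C_eq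

/-- `lineInput` of the instance is the cast of `lineInputQ`. -/
theorem lineInput_eq :
    WSCC9.postB_SPdamp.toModel.toLitNode.lineInput = lineInputQ.map (Rat.cast : ℚ → ℝ) := by
  ext i k
  have hdiv : ∀ x : ℝ, x / WSCC9.postB_SPdamp.toModel.toLitNode.M i = x * ((MinvQ i : ℚ) : ℝ) := by
    intro x; rw [tM', WSCC9LossySplitSlab.MinvQ]; push_cast; ring
  rcases k with ⟨p, q⟩ | ⟨p, q⟩ <;>
    simp only [InternalNode.lineInput, lineInputQ, Matrix.of_apply, Sum.elim_inl, Sum.elim_inr,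
      Matrix.map_apply, tC', tDtr', hdiv] <;> split_ifs <;> push_cast <;> ring

/-- `S.B = BLQ ↦ ℝ` (the unordered-lines input; RATIONAL). -/
theorem B_eq : WSCC9.splitLurieLinesSystem.B = BLQ.map (Rat.cast : ℚ → ℝ) := by
  rw [WSCC9.splitLurieLinesSystem_B, lineInput_eq]
  ext a k
  rcases a with i | m
  · simp [BLQ]
  · simp [BLQ]

/-! ### The blocks of the certificate matrix over `ℝ` are the casts -/

/-- State block. -/
theorem L11_eq : slabL11 WSCC9.splitLurieLinesSystem P (etaQ : ℝ) τ a b = L11Q.map (Rat.cast : ℚ → ℝ) := by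
  have hd : Matrix.diagonal (fun k => τ k * (a k * b k))
      = (Matrix.diagonal (fun k => tauK k * (aK k * bK k))).map (Rat.cast : ℚ → ℝ) := by
    rw [map_diagonal']
    congr 1; funext k; simp [τ, a, b]
  rw [slabL11, A_eq, C_eq, hd, P, L11Q]
  simp only [map_sub', map_add', map_mul', map_transpose', map_smul_one']

/-- Cross block. -/
theorem L12_eq : slabL12 WSCC9.splitLurieLinesSystem P lam τ a b = L12Q.map (Rat.cast : ℚ → ℝ) := by
  have hd1 : Matrix.diagonal lam = (Matrix.diagonal lamK).map (Rat.cast : ℚ → ℝ) := by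
    rw [map_diagonal']; rfl
  have hd2 : Matrix.diagonal (fun k => τ k * (a k + b k) / 2)
      = (Matrix.diagonal (fun k => tauK k * (aK k + bK k) / 2)).map (Rat.cast : ℚ → ℝ) := by
    rw [map_diagonal']
    congr 1; funext k; simp [τ, a, b]
  rw [slabL12, A_eq, B_eq, C_eq, hd1, hd2, P, L12Q]
  simp only [map_add', map_neg', map_mul', map_transpose']

/-- Channel block. -/
theorem L22_eq : slabL22 WSCC9.splitLurieLinesSystem lam τ = L22Q.map (Rat.cast : ℚ → ℝ) := by
  have hd1 : Matrix.diagonal lam = (Matrix.diagonal lamK).map (Rat.cast : ℚ → ℝ) := by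
    rw [map_diagonal']; rfl
  have hd3 : Matrix.diagonal τ = (Matrix.diagonal tauK).map (Rat.cast : ℚ → ℝ) := by
    rw [map_diagonal']; rfl
  rw [slabL22, B_eq, C_eq, hd1, hd3, L22Q]
  simp only [map_sub', map_neg', map_mul', map_transpose']

/-- **`−𝓛` over `ℝ` is the reindexed cast of `M2q`.** -/
theorem neg_slabMatrix_eq : -(slabMatrix WSCC9.splitLurieLinesSystem P (etaQ : ℝ) lam τ a b)
    = (M2q.map (Rat.cast : ℚ → ℝ)).submatrix e2 e2 := by
  rw [slabMatrix, L11_eq, L12_eq, L22_eq, ← map_transpose', ← Matrix.fromBlocks_map, ← map_neg', slabQ_eq]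
  rfl

/-- `P − ε·1` over `ℝ` is the reindexed cast of `Pq − epsQ·1`. -/
theorem P_sub_eq : P - (epsQ : ℝ) • (1 : Matrix (Fin 3 ⊕ Fin 2) (Fin 3 ⊕ Fin 2) ℝ)
    = ((Pq - epsQ • (1 : Matrix (Fin 5) (Fin 5) ℚ)).map (Rat.cast : ℚ → ℝ)).submatrix e1 e1 := by
  ext i j
  by_cases h : i = j
  · subst h; simp [P, PQ]
  · have h' : e1 i ≠ e1 j := fun he => h (e1.injective he)
    simp [P, PQ, h, h']

/-! ### The certificate -/

/-- **sos-2's UNORDERED-LINES SLAB CERTIFICATE «WSCC9SPLITU-slab-u7o100-well-eps» (γ = 2·arctan(7/100)) as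
lit-6's `SlabCertificate` for `WSCC9.splitLurieLinesSystem`**: data (`P`, `ε = 11501/2²⁴`, `η = 10⁻⁶`, `τ`,
`λ`, `a`, `b`) = the exact rationals of `WSCC9LossySplitLinesData`; `P − ε·1 ⪰ 0` and `−𝓛 ⪰ 0` from the
kernel-decided `LDLᵀ` facts through the identities `P_sub_eq` / `neg_slabMatrix_eq`.
[cite: Pai1981, §2.16 Theorem [18] eqs. (2.63)–(2.64), §3.6.3 eqs. (3.43)–(3.45); VuTuritsyn2017, §4.2 Lemma 1] -/
def cert : SlabCertificate WSCC9.splitLurieLinesSystem where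
  P := P
  ε := (epsQ : ℝ)
  η := (etaQ : ℝ)
  τ := τ
  lam := lam
  a := a
  b := b
  P_symm := by
    show (PQ.map (Rat.cast : ℚ → ℝ))ᵀ = PQ.map (Rat.cast : ℚ → ℝ)
    rw [← map_transpose', PQ_transpose]
  ε_pos := by exact_mod_cast eps_eta_pos.1
  η_pos := by exact_mod_cast eps_eta_pos.2
  P_ge := by
    rw [P_sub_eq]
    exact (Matrix.posSemidef_submatrix_equiv e1).2 posSemidef_M1_M2.1
  τ_nonneg := fun k => by unfold τ tauK; exact_mod_cast (mult_nonneg (eκ k)).1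
  lam_nonneg := fun k => by unfold lam lamK; exact_mod_cast (mult_nonneg (eκ k)).2
  a_nonneg_of_lam_pos := fun k hk => by
    unfold a aK
    have hk' : 0 < lamQ (eκ k) := by unfold lam lamK at hk; exact_mod_cast hk
    exact_mod_cast aQ_nonneg_of_lamQ_pos (eκ k) hk'
  lmi := by
    rw [neg_slabMatrix_eq]
    exact (Matrix.posSemidef_submatrix_equiv e2).2 posSemidef_M1_M2.2

/-- The certificate's slopes are the Data file's rationals (definitional). -/
theorem cert_a_b (k : (Fin 3 × Fin 3) ⊕ (Fin 3 × Fin 3)) :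
    cert.a k = ((aQ (eκ k) : ℚ) : ℝ) ∧ cert.b k = ((bQ (eκ k) : ℚ) : ℝ) := ⟨rfl, rfl⟩

/-- The certificate's `ε` is the Data file's rational (definitional). -/
theorem cert_ε : cert.ε = ((epsQ : ℚ) : ℝ) := rfl

/-! ### The rank-one facts in `S`-typed form -/

/-- **Rank-one facts** `s_k·P − C_kᵀC_k ⪰ 0` for every channel of `WSCC9.splitLurieLinesSystem`, with the dyadic
class constants `s_k` of the Data file. [cite: VuTuritsyn2017, §4.3 Theorem 1 (eq. V_min)] -/
theorem rankOne (k : (Fin 3 × Fin 3) ⊕ (Fin 3 × Fin 3)) :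
    (((sK k : ℚ) : ℝ) • cert.P
      - Matrix.vecMulVec (WSCC9.splitLurieLinesSystem.C k) (WSCC9.splitLurieLinesSystem.C k)).PosSemidef := by
  have hC : WSCC9.splitLurieLinesSystem.C k = fun i => ((CQ k i : ℚ) : ℝ) := by
    rw [C_eq]; rfl
  have h : ((sK k : ℚ) : ℝ) • cert.P
      - Matrix.vecMulVec (WSCC9.splitLurieLinesSystem.C k) (WSCC9.splitLurieLinesSystem.C k)
      = (sK k • PQ - Matrix.vecMulVec (CQ k) (CQ k)).map (Rat.cast : ℚ → ℝ) := by
    rw [hC, map_sub', map_smul', map_vecMulVec']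
    rfl
  rw [h, rankOneQ_eq k, ← Matrix.submatrix_map]
  exact (Matrix.posSemidef_submatrix_equiv e1).2 (posSemidef_rankOne _)

/-- `0 < s_k` (real). -/
theorem sK_pos (k : (Fin 3 × Fin 3) ⊕ (Fin 3 × Fin 3)) : (0 : ℝ) < ((sK k : ℚ) : ℝ) := by
  unfold sK; exact_mod_cast (cRk_test (eκ k)).1

end Summit.Ventures.GridStability.Lyapunov.WSCC9LossySplitLines

end
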